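import Summits.QuantumFields.YangMills.Theorems.PoincareLipschitzCovariantBridge
import Literature.MathematicalPhysics.QuantumFieldTheory.Balaban1983to89.B9Eq342SupNormBootstrap
import Literature.MathematicalPhysics.QuantumFieldTheory.Balaban1983to89.B5Eq129FreeResolventZoneSumSites
import HarnessLib

/-!
# Route `UnitScaleTilt`, crux K1 «MinimiserStabilityRegPr» (stmt-QuantumFields-19200), EX face after S45 — **(L3′b)-VALUE FILE V1: THE KATO BOOTSTRAP
# (ENERGY → SUP) INSTANTIATED AT THE T³ MEMBER** (★★OWNER RULING №35-A (b), 2026-08-30 04:18Z, on the chair's LOCATE-L3B-SUPNORM; chair ★`ym-ust-19200-p1` g25's own pen)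

Cell `ym3-torus` (HUMAN RULING D-0037; rung R3 = SU(2) YM₃ on T³ — NOT d = 4, NOT infinite volume, NOT a mass gap, NOT Clay).
THEOREMS ONLY (0 `def`, 0 `sorry`, default heartbeats); `--supports stmt-QuantumFields-19200 --as helper`; count-neutral.

WHY.  After the γ-row `hGF` falls (S45), the EX face of record keeps TEN print rows of [Balaban1985BackgroundPropagators] §3, ALL of them sup-norm ∕ pointwise bounds
of inverse operators (`norm_G`, `norm_H₁`, `norm_Hπ`, `h133`, `h88`, `h137kπ`, `h137kΔ`, `hCk`, `hPcol`, `h349`).  Their common engine is the ENERGY → SUP bridge, which is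
ABSTRACT in the tree: lit ✓`B9Eq342SupNormBootstrap.norm_le_of_kato_bootstrap_energy` (pub-balaban NE9; Kato domination [DodziukMathai2006] twice — NO random walk, NO window,
NO small field) for `(L + P)u = f` with `L` ANY Kato-form covariant graph Laplacian and the non-Kato part `P` entering only through a pointwise letter.  THIS FILE
instantiates it at the member `(F, n ≤ K)`: `L := Δ^η_{U₀} = covLapSite F n K c₀ U₀` (= lit `covLaplaceSiteK η⁻¹ (adBg …) (adBgInv …)` by `rfl`, ✓`covLapSite_eq`; Kato form by lit
✓`B9Eq323KatoDomination.equiv_covLaplaceSiteK_eq_sum`; the `SU(2)` transporters `Ad(U₀(b))` are Frobenius ISOMETRIES, ✓`norm_adW`), the flat scalar letter (FS) DISCHARGED at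
`d = 3` by lit ✓`B5Eq129FreeResolventZoneSumSites.hFS_tsite_diag` (`C₃ = √(3³∕(c₀ℓ³))`, `ℓ = L^{K−n}`, unit mass; level-free and volume-free), penalty `P` ABSTRACT.
WHAT IS PROVED (ns `Summit.QuantumFields.YangMills.Theorems.Prop7KatoBootstrapMember`).
* §1 `norm_adBg_eq`, `norm_adBgInv_eq` (the transporters are isometries of `W₂`), `adBgInv_adBg` (`R(U₀(b))⁻¹R(U₀(b)) = 1`);
  `eta_inv_le_periods` (`L^{K−n} ≤ 2L^{m+K}` = the `hvol` of the diagonal (FS) letter); `norm_eq_sqrt_sum_T3` (the weighted `L²` norm as `√Σ`).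
* §2 ★★★ `norm_apply_le_of_kato_member` — FOR EVERY background `U₀` (no `RegPr`, no window), every `c₀ > 0`, every `u f q` with `Δ^η_{U₀}u = f − q` (i.e. `(Δ^η_{U₀} + P)u = f`,
  `q = Pu`, `P` arbitrary): from the letters (E) `‖u‖ ≤ C_E‖f‖`, (P) `‖q(y)‖ ≤ Pq ≤ p₂‖u‖`, (supp) `‖f(y)‖ ≤ F_b`, `‖f‖ ≤ √μ·F_b`:
  `‖u(x)‖ ≤ (2 + (2p₂ + √(3³∕(c₀ℓ³)))·C_E·√μ)·F_b` at EVERY site — print's «|(G′(U)λ)(x)| ≤ B₀|λ|» shape ((3.42), first entry) for ANY massive∕penalised covariant site operator at the member;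
  ★★ `norm_apply_le_of_kato_member_block` — the same with `√μ := √(c₀·#S)` for `f` supported in a finite set `S` of sites (one block: `#S = ℓ³`, so `C₃√μ = √27` and `p₂√μ` is
  K-FREE exactly when `p₂ = O(1)∕√(c₀ℓ³)` — the block-averaging penalty's size at the chair's pin `cB = c₀ℓ³`).
USE (V2, next file): `G_a = (Δ_{U₀} + aQ″†Q″)⁻¹` of the LOD line (letters `T, G, hAG, hGA`): (E) := the landed (L2′-GAP), (P) := the spike row of `Q″` ⟹ `sup‖(G_af)(x)‖ ≤ B₀·sup‖f‖`, K-free;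
V3: decay edition (lit ✓`B9Eq342GreenPrimeSupBoundDecay` pattern fed by (L3′a)).  The GRADIENT half of (L3′b) is the Track-A∕R3 joint key and is NOT touched here.
HONEST SCOPE.  A composition of lit engines at the member's letters; CONDITIONAL on the displayed letters (E)(P)(supp); nothing of the ten rows, `hT`, `hGF`, (3.42)∕Thm 3.1 for print's
operators, EX `stub_existenceMinimalOrbit` or the crux is proved here.

References: T. Bałaban, CMP **99** (1985) 389–434 [Balaban1985BackgroundPropagators] ((3.3)∕(3.8) pp.391–392, (3.11) p.392, (3.23)–(3.25) p.394, (3.39) p.397, Thm 3.1 (3.42) p.397);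
J. Dodziuk, V. Mathai, Contemp. Math. **398** (2006) [DodziukMathai2006] (§1, Kato's inequality on weighted graphs); CMP **95** (1984) 17–40 [Balaban1984PropagatorsI] ((1.29)∕(1.31) p.23).
-/

set_option autoImplicit false

noncomputable section

open scoped InnerProductSpace ComplexConjugate BigOperators

namespace Summit.QuantumFields.YangMills.Theorems.Prop7KatoBootstrapMember

open Literature.MathematicalPhysics.QuantumFieldTheory.Balaban1983to89
open Literature.MathematicalPhysics.QuantumFieldTheory.Balaban1983to89.T3ContinuumYM3Torus
open B4Sect5Torus (TSite)
open B9SectCLatticeCarrier (Bond shift unshift)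
open B9Eq311L2Pairing (WL2)
open B11Eq103H1Complex (SiteL2K covLaplaceSiteK)
open B9Eq323KatoDomination (equiv_covLaplaceSiteK_eq_sum)
open B9Eq342SupNormBootstrap (norm_le_of_kato_bootstrap_energy)
open B5Eq129FreeResolventZoneSumSites (hFS_tsite_diag)
open T3SectALandauChart (eta eta_pos)
open Summit.QuantumFields.YangMills.Theorems.Prop7SectET3Transport (periodsT3 bgOfCfg isUnitaryBg_bgOfCfg)
open Summit.QuantumFields.YangMills.Theorems.Prop7SectET3HilbertLetters (W₂ adW adBg adBgInv covLapSite covLapSite_eq)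
open Summit.QuantumFields.YangMills.Theorems.PoincareLipschitzCovariantBridge (norm_adW adW_inv_adW)

variable (F : T3Family) (n K : ℕ) (c₀ : ℝ) [Fact (0 < c₀)]

/-! ## §1 The member's transporters are isometries; `η⁻¹ = ℓ`; the volume letter of the diagonal (FS) -/

/-- **(T) AT THE MEMBER**: `‖R(U₀(b))w‖ = ‖w‖` — `Ad` of an `SU(2)` bond variable is a Frobenius isometry of `W₂`. [cite: Balaban1985BackgroundPropagators, (3.3) p.391, (3.39) p.397] -/
theorem norm_adBg_eq (U₀ : GaugeField (F.P K) 0 (Matrix.specialUnitaryGroup (Fin 2) ℂ)) (b : Bond 3 (periodsT3 F K)) (w : W₂) :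
    ‖adBg F K U₀ b w‖ = ‖w‖ :=
  norm_adW _ (isUnitaryBg_bgOfCfg F K U₀ b) w

/-- **(T) FOR THE INVERSE TRANSPORTER**: `‖R(U₀(b))⁻¹w‖ = ‖w‖`. [cite: Balaban1985BackgroundPropagators, (3.5) p.391, (3.8) p.392] -/
theorem norm_adBgInv_eq (U₀ : GaugeField (F.P K) 0 (Matrix.specialUnitaryGroup (Fin 2) ℂ)) (b : Bond 3 (periodsT3 F K)) (w : W₂) :
    ‖adBgInv F K U₀ b w‖ = ‖w‖ := by
  have hU := isUnitaryBg_bgOfCfg F K U₀ b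
  have hU' : ((((bgOfCfg F K U₀ b)⁻¹)⁻¹ : (Matrix (Fin 2) (Fin 2) ℂ)ˣ) : Matrix (Fin 2) (Fin 2) ℂ) =
      star ((((bgOfCfg F K U₀ b)⁻¹ : (Matrix (Fin 2) (Fin 2) ℂ)ˣ)) : Matrix (Fin 2) (Fin 2) ℂ) := by
    rw [inv_inv, hU, star_star]
  exact norm_adW _ hU' w

/-- `R(U₀(b))⁻¹ (R(U₀(b)) w) = w` — the `hSR` of the Kato form of (3.23). [cite: Balaban1985BackgroundPropagators, (3.3) p.391, (3.8) p.392] -/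
theorem adBgInv_adBg (U₀ : GaugeField (F.P K) 0 (Matrix.specialUnitaryGroup (Fin 2) ℂ)) (b : Bond 3 (periodsT3 F K)) (w : W₂) :
    adBgInv F K U₀ b (adBg F K U₀ b w) = w :=
  adW_inv_adW _ w

/-- The volume letter of the diagonal (FS) row: `ℓ = L^{K−n} ≤ 2L^{m+K}` = the period of the finest lattice in every direction. [cite: Balaban1985BackgroundPropagators, (3.1) p.390] -/
theorem eta_inv_le_periods (hnK : n ≤ K) (ν : Fin 3) : (eta F n K)⁻¹ ≤ ((periodsT3 F K ν : ℕ) : ℝ) := by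
  rw [show (eta F n K)⁻¹ = (F.L : ℝ) ^ (K - n) by rw [eta, inv_pow, inv_inv]]
  have hP : periodsT3 F K ν = 2 * F.L ^ (F.m + K) := by
    show 2 * (F.P K).L ^ ((F.P K).m + (F.P K).K - 0) = 2 * F.L ^ (F.m + K)
    rfl
  rw [hP]
  have hL : (1 : ℝ) ≤ F.L := by have := F.hL.2; exact_mod_cast this.le
  have h1 : (F.L : ℝ) ^ (K - n) ≤ (F.L : ℝ) ^ (F.m + K) := pow_le_pow_right₀ hL (by omega)
  have h2 : (F.L : ℝ) ^ (F.m + K) ≤ 2 * (F.L : ℝ) ^ (F.m + K) := by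
    have : 0 ≤ (F.L : ℝ) ^ (F.m + K) := by positivity
    linarith
  have h3 : ((2 * F.L ^ (F.m + K) : ℕ) : ℝ) = 2 * (F.L : ℝ) ^ (F.m + K) := by push_cast; ring
  rw [h3]
  exact h1.trans h2

/-- Bookkeeping: the weighted `L²` norm (3.11) of the member IS `√(Σ_y c₀‖v(y)‖²)`. [cite: Balaban1985BackgroundPropagators, (3.11) p.392] -/
theorem norm_eq_sqrt_sum_T3 (v : SiteL2K ℂ 3 (periodsT3 F K) c₀ W₂) :
    ‖v‖ = Real.sqrt (∑ y, c₀ * ‖WL2.equiv ℂ _ W₂ v y‖ ^ 2) := by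
  rw [← WL2.norm_sq, Real.sqrt_sq (norm_nonneg _)]

/-! ## §2 The bootstrap at the member -/

/-- ★★★ **THE KATO BOOTSTRAP (ENERGY → SUP) AT THE T³ MEMBER, FOR EVERY BACKGROUND AND EVERY PENALTY.**  Let `U₀` be ANY configuration of the finest lattice of the member
`(F, n ≤ K)` and `u f q` gauge parameters in `L²(c₀)` with `Δ^η_{U₀}u = f − q` (so `(Δ^η_{U₀} + P)u = f` for any `P` with `Pu = q`).  If (E) `‖u‖ ≤ C_E‖f‖`, (P) `‖q(y)‖ ≤ Pq` with
`Pq ≤ p₂‖u‖`, and (supp) `‖f(y)‖ ≤ F_b`, `‖f‖ ≤ √μ·F_b`, then at EVERY site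
`‖u(x)‖ ≤ (2 + (2p₂ + √(3³∕(c₀·(L^{K−n})³)))·C_E·√μ)·F_b`.
Lit ✓`norm_le_of_kato_bootstrap_energy` at `ι := TSite 3 (periodsT3 F K)`, `J := Fin 3 ⊕ Fin 3`, weights `ℓ²`, transporters `R(U₀)⁻¹`∕`R(U₀)` (isometries), unit mass, the flat letter
(FS) discharged by lit ✓`hFS_tsite_diag` at `d = 3`.  CONDITIONAL on (E)(P)(supp). [cite: Balaban1985BackgroundPropagators, Thm 3.1 (3.42) p.397, (3.23)–(3.25) p.394] -/
theorem norm_apply_le_of_kato_member (hnK : n ≤ K) (U₀ : GaugeField (F.P K) 0 (Matrix.specialUnitaryGroup (Fin 2) ℂ))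
    {u f q : SiteL2K ℂ 3 (periodsT3 F K) c₀ W₂} (hu : covLapSite F n K c₀ U₀ u = f - q)
    {Fb Pq CE p₂ μ : ℝ} (hF : ∀ y, ‖WL2.equiv ℂ _ W₂ f y‖ ≤ Fb) (hPq : ∀ y, ‖WL2.equiv ℂ _ W₂ q y‖ ≤ Pq)
    (hp₂ : 0 ≤ p₂) (hCE : 0 ≤ CE) (hE : ‖u‖ ≤ CE * ‖f‖) (hPq₂ : Pq ≤ p₂ * ‖u‖) (hsupp : ‖f‖ ≤ Real.sqrt μ * Fb)
    (x : TSite 3 (periodsT3 F K)) :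
    ‖WL2.equiv ℂ _ W₂ u x‖ ≤ (2 + (2 * p₂ + Real.sqrt (3 ^ 3 / (c₀ * ((F.L : ℝ) ^ (K - n)) ^ 3))) * CE * Real.sqrt μ) * Fb := by
  have hc₀ : 0 < c₀ := Fact.out
  -- the difference quotient `t = η⁻¹ = ℓ`
  set t : ℝ := (eta F n K)⁻¹ with ht_def
  have ht : 0 < t := inv_pos.mpr (eta_pos F n K)
  have htL : t = (F.L : ℝ) ^ (K - n) := by rw [ht_def, eta, inv_pow, inv_inv]
  -- `Δ^η_{U₀}` IS lit's `covLaplaceSiteK` with the REAL quotient `t`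
  have hcast : (((eta F n K : ℝ) : ℂ))⁻¹ = (RCLike.ofReal t : ℂ) := by rw [ht_def]; exact (Complex.ofReal_inv _).symm
  have hsplit : covLaplaceSiteK (RCLike.ofReal t : ℂ) (adBg F K U₀) (adBgInv F K U₀) u = f - q := by
    have h0 : covLapSite F n K c₀ U₀ = covLaplaceSiteK (RCLike.ofReal t : ℂ) (adBg F K U₀) (adBgInv F K U₀) := by
      rw [covLapSite_eq, hcast]
    rw [← h0]; exact hu
  -- abstract data of the bootstrap
  let nbr : TSite 3 (periodsT3 F K) → Fin 3 ⊕ Fin 3 → TSite 3 (periodsT3 F K) :=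
    fun y j => Sum.elim (fun μ => unshift μ y) (fun μ => shift μ y) j
  let T : TSite 3 (periodsT3 F K) → Fin 3 ⊕ Fin 3 → W₂ →ₗ[ℂ] W₂ :=
    fun y j => Sum.elim (fun μ => adBgInv F K U₀ (unshift μ y, μ)) (fun μ => adBg F K U₀ (y, μ)) j
  have hT : ∀ y j v, ‖T y j v‖ ≤ ‖v‖ := fun y j v => by
    rcases j with μ | μ
    · exact (norm_adBgInv_eq F K U₀ _ v).le
    · exact (norm_adBg_eq F K U₀ _ v).le
  have hu' : ∀ y, ∑ j, (RCLike.ofReal (t ^ 2) : ℂ) • (WL2.equiv ℂ _ W₂ u y - T y j (WL2.equiv ℂ _ W₂ u (nbr y j))) =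
      WL2.equiv ℂ _ W₂ f y - WL2.equiv ℂ _ W₂ q y := by
    intro y
    have h := congr_arg (fun g => WL2.equiv ℂ _ W₂ g y) hsplit
    simp only [WL2.equiv_sub, Pi.sub_apply] at h
    rw [equiv_covLaplaceSiteK_eq_sum t _ _ (adBgInv_adBg F K U₀) u y] at h
    rw [← h, Fintype.sum_sum_type, ← Finset.sum_add_distrib]
    refine Finset.sum_congr rfl fun μ _ => ?_
    rw [← smul_add]; rfl
  -- the flat scalar letter (FS) at `d = 3`, unit mass, DISCHARGED (lit, level-free): `C₃ = √(3³∕(c₀t³))`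
  have hvol : ∀ ν, t ≤ ((periodsT3 F K ν : ℕ) : ℝ) := fun ν => eta_inv_le_periods F n K hnK ν
  have hFS := hFS_tsite_diag (periodsT3 F K) (d := 3) (by norm_num) ht hc₀ (c₁ := c₀ * t ^ 3) rfl hvol
  have hC₃ : 0 ≤ Real.sqrt (3 ^ 3 / (c₀ * t ^ 3)) := Real.sqrt_nonneg _
  -- the letters in the bootstrap's currency
  have hEn : Real.sqrt (∑ y, c₀ * ‖WL2.equiv ℂ _ W₂ u y‖ ^ 2) ≤ CE * Real.sqrt (∑ y, c₀ * ‖WL2.equiv ℂ _ W₂ f y‖ ^ 2) := by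
    rw [← norm_eq_sqrt_sum_T3, ← norm_eq_sqrt_sum_T3]; exact hE
  have hPq₂' : Pq ≤ p₂ * Real.sqrt (∑ y, c₀ * ‖WL2.equiv ℂ _ W₂ u y‖ ^ 2) := by rw [← norm_eq_sqrt_sum_T3]; exact hPq₂
  have hsupp' : Real.sqrt (∑ y, c₀ * ‖WL2.equiv ℂ _ W₂ f y‖ ^ 2) ≤ Real.sqrt μ * Fb := by rw [← norm_eq_sqrt_sum_T3]; exact hsupp
  have h := norm_le_of_kato_bootstrap_energy (𝕜 := ℂ) nbr (fun _ _ => t ^ 2) (fun _ _ => sq_nonneg _) T hT (fun _ => c₀) one_pos hC₃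
    hFS hu' hF hPq hp₂ hCE hEn hPq₂' hsupp' x
  rw [htL] at h
  calc ‖WL2.equiv ℂ _ W₂ u x‖ ≤ (2 / 1 + (2 * p₂ / 1 + 1 ^ 2 * Real.sqrt (3 ^ 3 / (c₀ * ((F.L : ℝ) ^ (K - n)) ^ 3))) * CE * Real.sqrt μ) * Fb := h
    _ = (2 + (2 * p₂ + Real.sqrt (3 ^ 3 / (c₀ * ((F.L : ℝ) ^ (K - n)) ^ 3))) * CE * Real.sqrt μ) * Fb := by ring

/-- ★★ **THE BOOTSTRAP FOR BLOCK-SUPPORTED DATA**: if moreover `f` vanishes off a finite set `S` of sites, then `‖f‖ ≤ √(c₀·#S)·F_b`, so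
`‖u(x)‖ ≤ (2 + (2p₂ + √(3³∕(c₀ℓ³)))·C_E·√(c₀·#S))·F_b`; for ONE BLOCK (`#S = ℓ³`, `ℓ = L^{K−n}`) the scalar part is `√(c₀ℓ³)·√(27∕(c₀ℓ³)) = √27` — K-FREE — and the penalty part
`p₂·√(c₀ℓ³)` is K-free exactly for `p₂ = O(1)∕√(c₀ℓ³)`. [cite: Balaban1985BackgroundPropagators, Thm 3.1 (3.42) p.397 («supp λ ⊂ Δ(y′)»), (3.11) p.392] -/
theorem norm_apply_le_of_kato_member_block (hnK : n ≤ K) (U₀ : GaugeField (F.P K) 0 (Matrix.specialUnitaryGroup (Fin 2) ℂ))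
    {u f q : SiteL2K ℂ 3 (periodsT3 F K) c₀ W₂} (hu : covLapSite F n K c₀ U₀ u = f - q)
    (S : Finset (TSite 3 (periodsT3 F K))) (hfS : ∀ y, y ∉ S → WL2.equiv ℂ _ W₂ f y = 0)
    {Fb Pq CE p₂ : ℝ} (hF : ∀ y, ‖WL2.equiv ℂ _ W₂ f y‖ ≤ Fb) (hPq : ∀ y, ‖WL2.equiv ℂ _ W₂ q y‖ ≤ Pq)
    (hp₂ : 0 ≤ p₂) (hCE : 0 ≤ CE) (hE : ‖u‖ ≤ CE * ‖f‖) (hPq₂ : Pq ≤ p₂ * ‖u‖)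
    (x : TSite 3 (periodsT3 F K)) :
    ‖WL2.equiv ℂ _ W₂ u x‖ ≤ (2 + (2 * p₂ + Real.sqrt (3 ^ 3 / (c₀ * ((F.L : ℝ) ^ (K - n)) ^ 3))) * CE * Real.sqrt (c₀ * S.card)) * Fb := by
  have hc₀ : 0 < c₀ := Fact.out
  have hFb : 0 ≤ Fb := (norm_nonneg _).trans (hF x)
  -- `‖f‖² = Σ_{y ∈ S} c₀‖f y‖² ≤ c₀·#S·Fb²`
  have hsupp : ‖f‖ ≤ Real.sqrt (c₀ * S.card) * Fb := by
    have hsq : ‖f‖ ^ 2 ≤ (Real.sqrt (c₀ * S.card) * Fb) ^ 2 := by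
      rw [WL2.norm_sq, mul_pow, Real.sq_sqrt (by positivity)]
      have hsplit : ∑ y, c₀ * ‖WL2.equiv ℂ _ W₂ f y‖ ^ 2 = ∑ y ∈ S, c₀ * ‖WL2.equiv ℂ _ W₂ f y‖ ^ 2 := by
        rw [← Finset.sum_subset (Finset.subset_univ S)]
        intro y _ hy
        rw [hfS y hy, norm_zero]; ring
      rw [hsplit]
      calc ∑ y ∈ S, c₀ * ‖WL2.equiv ℂ _ W₂ f y‖ ^ 2 ≤ ∑ y ∈ S, c₀ * Fb ^ 2 := by
            refine Finset.sum_le_sum fun y _ => ?_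
            exact mul_le_mul_of_nonneg_left (pow_le_pow_left₀ (norm_nonneg _) (hF y) 2) hc₀.le
        _ = c₀ * S.card * Fb ^ 2 := by rw [Finset.sum_const, nsmul_eq_mul]; ring
    have h0 : 0 ≤ Real.sqrt (c₀ * S.card) * Fb := by positivity
    exact (pow_le_pow_iff_left₀ (norm_nonneg _) h0 two_ne_zero).mp hsq
  exact norm_apply_le_of_kato_member F n K c₀ hnK U₀ hu hF hPq hp₂ hCE hE hPq₂ hsupp x

end Summit.QuantumFields.YangMills.Theorems.Prop7KatoBootstrapMember

end
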